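import Summits.QuantumFields.BalabanUV.Beta.WardLocusParitySplit
import Summits.QuantumFields.BalabanUV.Beta.WardLocusWilsonEnd

/-!
# `BalabanUV.Beta.WardLocusParityLevels` — binder row D1, (L4) W-side of hW: LEVEL REDUCTION — the hW END from THREE LEVEL-0 EVEN-HALF WARD LAWS
# (border divergence first ∕ second slot, mixed divergence); the level-`j` laws of `WardLocusParitySplit` are their scalar multiples
# (β sub-cell, D1 formalisation swarm, unit `b2b-balaban-beta-d1-formalise-leaf-06`, gen 3; «D1-hW-PARITY-LEVELS», first refusal taken from an3-g33's AN3-33B)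

NOT IN PRINT; OUR BOOKKEEPING.  HONEST FRAMING (cell charter, verbatim): «discharging `BetaPertH` makes Bałaban's UV stability UNCONDITIONAL — a real
constructive-QFT result; it is NOT the continuum limit and NOT the Clay problem.»  HONEST DEPENDENCY (verbatim): «continuum YM on T⁴ ⇐ BetaPertH ∧ nine spine
estimates (0/9 proved); BetaPertH ⇐ (D1) ∧ (D4) ∧ CAP+tail; G-an2-4 gates asym, D1 and NE2/3/4.»  [folklore] scalar algebra of the level weights
(`wB2 = wVH·stepScale`, `wM2 = wM1·stepScale`) and linearity of `divV`, `comp`, `trK`, `sgnK`; composition BY NAME of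
`WardLocusParitySplit.wardTransversal_flipK_TbalOf_JsRecWAtOf_TW_su_of_evenHalf_laws` (even-half currency, §3) and of
`WardLocusWilsonEnd.wardTransversal_flipK_TbalOf_JsRecWAtOf_TW_su_exact` (exact ∕ residual currency, §4).  The three level-0 laws and the pin stay DISPLAYED
HYPOTHESES; no statement of Bałaban's papers, no `[cite:]`, no `def`, no `def … : Prop`; instantiates NO binder of the β-function wall.  NOT hW, NOT D1,
NOT `BetaPertH`, NOT continuum, NOT Clay.

WHY THE LEVELS COLLAPSE.  In the level-`j+1` border law both the divergence `(stepScale (j+1)·Lc⁴)⁻¹ • Σ_v divV ((cB·wB2 (j+1)) • vh₂S …)` and the commutator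
`[(c′·wVH (j+1)) • vhSAt′, D]` are `wVH (j+1) •` their level-0 counterparts (`wB2 = wVH·stepScale`, the tables are `j`-free); in the level-`j` mixed law both
`(stepScale j·Lc⁴)⁻¹ • Σ_v divV (M2Of j …)` (`M2Of j = wM2 j • mixFF`) and `[M1At j, D]` (`M1At j = (cΛ·wM1 j) • hessFFAt`) are `wM1 j •` the level-0 sides
(`wM2 = wM1·stepScale`); and an even-half law `L + sgnK (trK L) = 2 • C` is homogeneous under a common scalar.

* §1 `wB2_eq_wVH_mul_stepScale`, `wM2_eq_wM1_mul_stepScale`, `cH_mul_wB2`, `cH_mul_wM2` (generic `d`); §2 `smul_sum_divV_smul`, `M1At_eq_smul_zero_level`,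
  `comm_smul`, `evenHalf_law_smul`; §3 **`wardTransversal_flipK_TbalOf_JsRecWAtOf_TW_su_of_evenHalf_laws₀`** (`d = 3`, `T_W := (8N²)⁻¹ • wsym22 N`, every
  `SU(N)` with `2 ≤ N`, pin `cE₂ = Lc^{2(3+1)}`): hW(v2.26-W) for the recursive W-literal ⟸ EXACTLY THREE LEVEL-0 EVEN-HALF WARD LAWS (W-B₀) `hE0`, (W-B₀″)
  `hE0''`, (W-M₀) `hEM0` + `hBt`∕`hmixt`; §4 `exact_law_smul`, `residual_law_smul`, `vertexFamily_smul`, and the EXACT ∕ RESIDUAL-CURRENCY twin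
  **`wardTransversal_flipK_TbalOf_JsRecWAtOf_TW_su_exact₀`** (same frame): hW ⟸ the two EXACT level-0 border Ward letters `hBord0`∕`hBord0''` and the
  level-0 mixed Ward letter `hM₂0` with ONE residual table `RM₀` (one `VertexFamily` class, row-parity-odd), the level family fed to p220335 being
  `fun j y ρ' w => wM1 3 Lc j • RM₀ y ρ' w` (requested by an3-g33, journal l.14915; for an anti-twin-placed table the two currencies coincide,
  `WardLocusParitySplit.evenHalf_law_iff_of_even`).
Provenance: D1 formalisation swarm, leaf prover 06 (gen 3), 2026-08-20; no existing file touched.  an3-g33's unfiled reference bytes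
`HOME/b2b-balaban-beta-an3/gen33/WardLetterLevels.v1.…lean` (same END over a `def levelsW`) were read; this file keeps `0 def` and reuses §1–§2 instead.
-/

noncomputable section

open Finset
open scoped BigOperators
open Literature.MathematicalPhysics.QuantumFieldTheory
open Literature.MathematicalPhysics.QuantumFieldTheory.Balaban1983to89
open Literature.MathematicalPhysics.QuantumFieldTheory.Balaban1983to89.Beta
open ExpKernelCalculus (MKer Decays BiLoc VertexFamily VertexFamily₂ comp shiftK)
open KernelWard (divV divW)
open AffineAveraging (Site box toSite)
open OneStepResolventKernel (Fib LocStencil)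
open OneStepKernelFamily (KInvStep TbalOf flipK)
open PolarizationSign (WardTransversal)
open BalabanStepJetsSucc (wE wVH)
open SecondOrderResponse (LocStencilFM biLoc_smul)
open BalabanCompositeJets (LocStencil₂)
open BalabanStepW2 (M2Of wV4 wB2 wM1 wM2)
open StepJetData (wilsonA)
open WilsonVertex2Sym (wsym22)
open AveragingHessianKernelsRooted (vhSAt)
open Summit.QuantumFields.BalabanUV.Beta.TameKernelCalculus
open Summit.QuantumFields.BalabanUV.Beta.BorderedHessian (diagK stepScale sgnK)
open Summit.QuantumFields.BalabanUV.Beta.AveragingWardRootedStencils (legInd)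
open Summit.QuantumFields.BalabanUV.Beta.SpineRooted (M1At JsRecWAtOf)
open Summit.QuantumFields.BalabanUV.Beta.SpineRecursiveParity (sgnK_smul trK_smul parityOdd_smul)
open Summit.QuantumFields.BalabanUV.Beta.WardLocusQuartic (divV_smul)
open Summit.QuantumFields.BalabanUV.Beta.KernelWardLevels (stepScale_zero)
open Summit.QuantumFields.BalabanUV.Beta.WardLocusParitySplit (wardTransversal_flipK_TbalOf_JsRecWAtOf_TW_su_of_evenHalf_laws)
open Summit.QuantumFields.BalabanUV.Beta.WardLocusWilsonEnd (wardTransversal_flipK_TbalOf_JsRecWAtOf_TW_su_exact)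

namespace Summit.QuantumFields.BalabanUV.Beta.WardLocusParityLevels

/-! ## §1 The level weights -/

section Weights

variable (d Lc : ℕ)

/-- [folklore] `wB2 j = wVH j · stepScale j` (`(Lc^j)^{3(d+2)} = (Lc^j)^{2(d+2)} · (Lc^j)^{d+2}`). -/
theorem wB2_eq_wVH_mul_stepScale (j : ℕ) : wB2 d Lc j = wVH d Lc j * stepScale d Lc j := by
  simp only [BalabanStepW2.wB2, BalabanStepJetsSucc.wVH, BorderedHessian.stepScale]
  ring

/-- [folklore] `wM2 j = wM1 j · stepScale j`. -/
theorem wM2_eq_wM1_mul_stepScale (j : ℕ) : wM2 d Lc j = wM1 d Lc j * stepScale d Lc j := by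
  simp only [BalabanStepW2.wM2, BalabanStepW2.wM1, BorderedHessian.stepScale]
  ring

variable {d Lc}

/-- [folklore] `cH j · (cB·wB2 j) = wVH j · (cH 0 · cB)` with `cH j := (stepScale j · Lc^{d+1})⁻¹` (`Lc ≥ 1`). -/
theorem cH_mul_wB2 (hLc : 1 ≤ Lc) (cB : ℝ) (j : ℕ) :
    (stepScale d Lc j * (Lc : ℝ) ^ (d + 1))⁻¹ * (cB * wB2 d Lc j) = wVH d Lc j * ((stepScale d Lc 0 * (Lc : ℝ) ^ (d + 1))⁻¹ * cB) := by
  have hL0 : (Lc : ℝ) ≠ 0 := by exact_mod_cast (show Lc ≠ 0 by omega)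
  have hs : stepScale d Lc j ≠ 0 := by
    simp only [BorderedHessian.stepScale]; exact pow_ne_zero _ (pow_ne_zero _ hL0)
  have hL : (Lc : ℝ) ^ (d + 1) ≠ 0 := pow_ne_zero _ hL0
  rw [wB2_eq_wVH_mul_stepScale, stepScale_zero, one_mul]
  field_simp

/-- [folklore] `cH j · wM2 j = wM1 j · cH 0` (`wM2 0 = 1` is not needed: we keep `M2Of 0` on the level-0 side, so the identity used is
`cH j · wM2 j = wM1 j · (cH 0 · wM2 0)`). -/
theorem cH_mul_wM2 (hLc : 1 ≤ Lc) (j : ℕ) :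
    (stepScale d Lc j * (Lc : ℝ) ^ (d + 1))⁻¹ * wM2 d Lc j = wM1 d Lc j * ((stepScale d Lc 0 * (Lc : ℝ) ^ (d + 1))⁻¹ * wM2 d Lc 0) := by
  have hL0 : (Lc : ℝ) ≠ 0 := by exact_mod_cast (show Lc ≠ 0 by omega)
  have hs : stepScale d Lc j ≠ 0 := by
    simp only [BorderedHessian.stepScale]; exact pow_ne_zero _ (pow_ne_zero _ hL0)
  have hL : (Lc : ℝ) ^ (d + 1) ≠ 0 := pow_ne_zero _ hL0
  have h0 : wM2 d Lc 0 = 1 := by simp [BalabanStepW2.wM2]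
  rw [wM2_eq_wM1_mul_stepScale d Lc j, stepScale_zero, one_mul, h0, mul_one]
  field_simp

end Weights

/-! ## §2 Linearity: the three divergences and the commutators scale -/

section Linear

variable {d Lc : ℕ}

/-- [folklore] `a • Σ_v divV (fun κ u => c • F κ u) (g v) = (a·c) • Σ_v divV F (g v)`. -/
theorem smul_sum_divV_smul {ι : Type*} (s : Finset ι) (g : ι → Fin (d + 1) → ℤ) (a c : ℝ)
    (F : Fin (d + 1) → (Fin (d + 1) → ℤ) → MKer (d + 1) (Fib d)) :
    a • ∑ i ∈ s, divV (fun κ u => c • F κ u) (g i) = (a * c) • ∑ i ∈ s, divV F (g i) := by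
  simp only [divV_smul, ← Finset.smul_sum, smul_smul]

/-- [folklore] `M1At j = wM1 j • M1At 0` (`wM1 0 = 1`). -/
theorem M1At_eq_smul_zero_level [NeZero Lc] (ρ : Fin (d + 1) → ℤ) (cΛ : ℝ) (j : ℕ) (μ : Fin (d + 1)) (w : Fin (d + 1) → ℤ) :
    M1At d Lc ρ cΛ j μ w = wM1 d Lc j • M1At d Lc ρ cΛ 0 μ w := by
  have h0 : wM1 d Lc 0 = 1 := by simp [BalabanStepW2.wM1]
  simp only [SpineRooted.M1At, smul_smul, h0, mul_one, mul_comm (wM1 d Lc j) cΛ]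

/-- [folklore] `M2Of j κ u ρ w = wM2 j • mixFF κ u ρ w` (by `rfl`). -/
theorem M2Of_apply (mixFF : Fin (d + 1) → (Fin (d + 1) → ℤ) → Fin (d + 1) → (Fin (d + 1) → ℤ) → MKer (d + 1) (Fib d)) (j : ℕ)
    (κ : Fin (d + 1)) (u : Fin (d + 1) → ℤ) (ρ : Fin (d + 1)) (w : Fin (d + 1) → ℤ) :
    M2Of d Lc mixFF j κ u ρ w = wM2 d Lc j • mixFF κ u ρ w := rfl

/-- [folklore] The commutator with a fixed kernel is linear: `[w • T, D] = w • [T, D]`. -/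
theorem comm_smul (w : ℝ) (T D : MKer (d + 1) (Fib d)) : comp (w • T) D - comp D (w • T) = w • (comp T D - comp D T) := by
  rw [KernelReflection.comp_smul_left, KernelReflection.comp_smul_right, smul_sub]

/-- [folklore] **EVEN-HALF LAWS SCALE**: `L = w • L₀`, `C = w • C₀`, `L₀ + sgnK (trK L₀) = 2 • C₀` ⇒ `L + sgnK (trK L) = 2 • C`. -/
theorem evenHalf_law_smul {L L₀ C C₀ : MKer (d + 1) (Fib d)} {w : ℝ} (hL : L = w • L₀) (hC : C = w • C₀)
    (h : L₀ + sgnK (trK L₀) = (2 : ℝ) • C₀) : L + sgnK (trK L) = (2 : ℝ) • C := by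
  rw [hL, hC, trK_smul, sgnK_smul, ← smul_add, h, smul_comm]

/-- [folklore] **EXACT LAWS SCALE**: `L = w • L₀`, `C = w • C₀`, `L₀ = C₀` ⇒ `L = C`. -/
theorem exact_law_smul {L L₀ C C₀ : MKer (d + 1) (Fib d)} {w : ℝ} (hL : L = w • L₀) (hC : C = w • C₀) (h : L₀ = C₀) : L = C := by
  rw [hL, hC, h]

/-- [folklore] **RESIDUAL LAWS SCALE**: `L = w • L₀`, `C = w • C₀`, `L₀ = C₀ + R₀` ⇒ `L = C + w • R₀`. -/
theorem residual_law_smul {L L₀ C C₀ R₀ : MKer (d + 1) (Fib d)} {w : ℝ} (hL : L = w • L₀) (hC : C = w • C₀) (h : L₀ = C₀ + R₀) :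
    L = C + w • R₀ := by
  rw [hL, hC, h, smul_add]

/-- [folklore] A `VertexFamily` class is stable under a scalar (constant `|w| · C`). -/
theorem vertexFamily_smul {R : Fin (d + 1) → (Fin (d + 1) → ℤ) → MKer (d + 1) (Fib d)} {C δ : ℝ} (w : ℝ) (h : VertexFamily R Lc C δ) :
    VertexFamily (fun ν y' => w • R ν y') Lc (|w| * C) δ :=
  fun ν y' => biLoc_smul w (h ν y')

end Linear

/-! ## §3 The hW END from three level-0 even-half Ward laws (`d = 3`, `T_W`, colour-free) -/

section End

variable {Lc N : ℕ} [NeZero Lc]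

/-- [folklore] **hW(v2.26-W) AT `T_W`, EVERY `SU(N)` (`2 ≤ N`), FROM THREE LEVEL-0 EVEN-HALF WARD LAWS** (`d = 3`, `1 ≤ Lc`, in-block root, pin
`cE₂ = Lc^{2(3+1)}`): the level-0 border laws (W-B₀) `hE0` ∕ (W-B₀″) `hE0''` and the level-0 mixed law (W-M₀) `hEM0`, + `hBt`∕`hmixt`, give
`∀ j, WardTransversal (flipK (TbalOf Lc (JsRecWAtOf hLc hr Lc⁴ (−Lc⁴·½·Lc⁴) cΛ cE₂ cB ((8N²)⁻¹ • wsym22 N) hB hmix) j))` —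
`WardLocusParitySplit.wardTransversal_flipK_TbalOf_JsRecWAtOf_TW_su_of_evenHalf_laws` with its level-`j+1` border laws and level-`j` mixed laws obtained from the
level-0 ones by the scalings `wVH (j+1)` ∕ `wM1 j` (§1–§2). -/
theorem wardTransversal_flipK_TbalOf_JsRecWAtOf_TW_su_of_evenHalf_laws₀ (hN : 2 ≤ N)
    (hLc : 1 ≤ Lc) {r : Fin (3 + 1) → ℕ} (hr : r ∈ box (3 + 1) Lc) (cΛ cB : ℝ) {cE₂ : ℝ}
    (hcE₂ : cE₂ = (Lc : ℝ) ^ (2 * (3 + 1)))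
    {vh₂S : Fin (3 + 1) → (Fin (3 + 1) → ℤ) → Fin (3 + 1) → (Fin (3 + 1) → ℤ) → MKer (3 + 1) (Fib 3)}
    (hB : ∃ C δ : ℝ, 0 < δ ∧ LocStencil₂ vh₂S C δ)
    (hBt : ∀ (κ : Fin (3 + 1)) (u : Fin (3 + 1) → ℤ) (κ' : Fin (3 + 1)) (u' t : Fin (3 + 1) → ℤ),
      vh₂S κ (u + (Lc : ℤ) • t) κ' (u' + (Lc : ℤ) • t) = shiftK (-((Lc : ℤ) • t)) (vh₂S κ u κ' u'))
    {mixFF : Fin (3 + 1) → (Fin (3 + 1) → ℤ) → Fin (3 + 1) → (Fin (3 + 1) → ℤ) → MKer (3 + 1) (Fib 3)}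
    (hmix : ∃ C δ : ℝ, 0 < δ ∧ LocStencilFM Lc mixFF C δ)
    (hmixt : ∀ (κ : Fin (3 + 1)) (u : Fin (3 + 1) → ℤ) (μ : Fin (3 + 1)) (w t : Fin (3 + 1) → ℤ),
      mixFF κ (u + (Lc : ℤ) • t) μ (w + t) = shiftK (-((Lc : ℤ) • t)) (mixFF κ u μ w))
    (hE0 : ∀ (Y : Fin (3 + 1) → ℤ) (κ' : Fin (3 + 1)) (u' : Fin (3 + 1) → ℤ),
      (stepScale 3 Lc 0 * (Lc : ℝ) ^ (3 + 1))⁻¹ • ∑ v ∈ box (3 + 1) Lc, divV (fun κ u => cB • vh₂S κ u κ' u') ((Lc : ℤ) • Y + toSite v)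
          + sgnK (trK ((stepScale 3 Lc 0 * (Lc : ℝ) ^ (3 + 1))⁻¹ • ∑ v ∈ box (3 + 1) Lc, divV (fun κ u => cB • vh₂S κ u κ' u') ((Lc : ℤ) • Y + toSite v))) =
        (2 : ℝ) • (comp ((-((Lc : ℝ) ^ (3 + 1) * (1 / 2) * (Lc : ℝ) ^ (3 + 1))) • vhSAt (toSite r) 3 Lc rfl κ' u') (diagK (((1 : ℝ) / 2) • ∑ v ∈ box (3 + 1) Lc, legInd (toSite r) ((Lc : ℤ) • Y + toSite v)))
          - comp (diagK (((1 : ℝ) / 2) • ∑ v ∈ box (3 + 1) Lc, legInd (toSite r) ((Lc : ℤ) • Y + toSite v))) ((-((Lc : ℝ) ^ (3 + 1) * (1 / 2) * (Lc : ℝ) ^ (3 + 1))) • vhSAt (toSite r) 3 Lc rfl κ' u')))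
    (hE0'' : ∀ (Y : Fin (3 + 1) → ℤ) (κ : Fin (3 + 1)) (u : Fin (3 + 1) → ℤ),
      (stepScale 3 Lc 0 * (Lc : ℝ) ^ (3 + 1))⁻¹ • ∑ v ∈ box (3 + 1) Lc, divV (fun κ' u' => cB • vh₂S κ u κ' u') ((Lc : ℤ) • Y + toSite v)
          + sgnK (trK ((stepScale 3 Lc 0 * (Lc : ℝ) ^ (3 + 1))⁻¹ • ∑ v ∈ box (3 + 1) Lc, divV (fun κ' u' => cB • vh₂S κ u κ' u') ((Lc : ℤ) • Y + toSite v))) =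
        (2 : ℝ) • (comp ((-((Lc : ℝ) ^ (3 + 1) * (1 / 2) * (Lc : ℝ) ^ (3 + 1))) • vhSAt (toSite r) 3 Lc rfl κ u) (diagK (((1 : ℝ) / 2) • ∑ v ∈ box (3 + 1) Lc, legInd (toSite r) ((Lc : ℤ) • Y + toSite v)))
          - comp (diagK (((1 : ℝ) / 2) • ∑ v ∈ box (3 + 1) Lc, legInd (toSite r) ((Lc : ℤ) • Y + toSite v))) ((-((Lc : ℝ) ^ (3 + 1) * (1 / 2) * (Lc : ℝ) ^ (3 + 1))) • vhSAt (toSite r) 3 Lc rfl κ u)))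
    (hEM0 : ∀ (y : Fin (3 + 1) → ℤ) (ρ' : Fin (3 + 1)) (w : Fin (3 + 1) → ℤ),
      (stepScale 3 Lc 0 * (Lc : ℝ) ^ (3 + 1))⁻¹ • ∑ v ∈ box (3 + 1) Lc, divV (fun κ u => M2Of 3 Lc mixFF 0 κ u ρ' w) ((Lc : ℤ) • y + toSite v)
          + sgnK (trK ((stepScale 3 Lc 0 * (Lc : ℝ) ^ (3 + 1))⁻¹ • ∑ v ∈ box (3 + 1) Lc, divV (fun κ u => M2Of 3 Lc mixFF 0 κ u ρ' w) ((Lc : ℤ) • y + toSite v))) =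
        (2 : ℝ) • (comp (M1At 3 Lc (toSite r) cΛ 0 ρ' w) (diagK (((1 : ℝ) / 2) • ∑ v ∈ box (3 + 1) Lc, legInd (toSite r) ((Lc : ℤ) • y + toSite v)))
          - comp (diagK (((1 : ℝ) / 2) • ∑ v ∈ box (3 + 1) Lc, legInd (toSite r) ((Lc : ℤ) • y + toSite v))) (M1At 3 Lc (toSite r) cΛ 0 ρ' w))) :
    ∀ j : ℕ, WardTransversal (flipK (TbalOf Lc
      (JsRecWAtOf (d := 3) hLc hr ((Lc : ℝ) ^ (3 + 1)) (-((Lc : ℝ) ^ (3 + 1) * (1 / 2) * (Lc : ℝ) ^ (3 + 1))) cΛ cE₂ cB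
        ((8 * (N : ℝ) ^ 2)⁻¹ • wsym22 N) hB hmix) j)) := by
  refine wardTransversal_flipK_TbalOf_JsRecWAtOf_TW_su_of_evenHalf_laws hN hLc hr cΛ cB hcE₂ hB hBt hmix hmixt hE0 hE0''
    (fun j Y κ' u' => ?_) (fun j Y κ u => ?_) (fun j y ρ' w => ?_)
  · -- border, first slot, level j+1 from level 0
    refine evenHalf_law_smul (w := wVH 3 Lc (j + 1)) ?_ ?_ (hE0 Y κ' u')
    · rw [smul_sum_divV_smul, smul_sum_divV_smul, smul_smul, cH_mul_wB2 hLc cB (j + 1)]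
    · rw [← comm_smul, smul_smul, mul_comm (wVH 3 Lc (j + 1))]
  · -- border, second slot
    refine evenHalf_law_smul (w := wVH 3 Lc (j + 1)) ?_ ?_ (hE0'' Y κ u)
    · rw [smul_sum_divV_smul, smul_sum_divV_smul, smul_smul, cH_mul_wB2 hLc cB (j + 1)]
    · rw [← comm_smul, smul_smul, mul_comm (wVH 3 Lc (j + 1))]
  · -- mixed, level j from level 0
    refine evenHalf_law_smul (w := wM1 3 Lc j) ?_ ?_ (hEM0 y ρ' w)
    · simp only [M2Of_apply]
      rw [smul_sum_divV_smul, smul_sum_divV_smul, smul_smul, cH_mul_wM2 hLc j]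
    · rw [← comm_smul, ← M1At_eq_smul_zero_level]

end End

/-! ## §4 The exact ∕ residual currency: p220335's `_TW_su_exact` from three level-0 Ward letters -/

section Exact

variable {Lc N : ℕ} [NeZero Lc]

/-- [folklore] **hW(v2.26-W) AT `T_W`, EVERY `SU(N)` (`2 ≤ N`), FROM THREE LEVEL-0 WARD LETTERS IN THE EXACT ∕ RESIDUAL CURRENCY** (`d = 3`,
`1 ≤ Lc`, in-block root, pin `cE₂ = Lc^{2(3+1)}`): the two EXACT level-0 border Ward letters (W-B₀) `hBord0` ∕ (W-B₀″) `hBord0''` and the level-0 mixed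
Ward letter (W-M₀) `hM₂0` with ONE residual table `RM₀` (one `VertexFamily` class `hclsM₀`, row-parity-odd `hRM₀p`), + `hBt`∕`hmixt`, give
`∀ j, WardTransversal (flipK (TbalOf Lc (JsRecWAtOf hLc hr Lc⁴ (−Lc⁴·½·Lc⁴) cΛ cE₂ cB ((8N²)⁻¹ • wsym22 N) hB hmix) j))` —
`WardLocusWilsonEnd.wardTransversal_flipK_TbalOf_JsRecWAtOf_TW_su_exact` (p220335) with `RM := fun j y ρ' w => wM1 3 Lc j • RM₀ y ρ' w`, its `∀ j`
border letters `hBordS`∕`hBordS″` and mixed letters `hM₂` obtained from the level-0 ones by the scalings `wVH (j+1)` ∕ `wM1 j` (§1–§2).  Twin of §3 in the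
other currency (an3-g33's request, journal l.14915); for an anti-twin-placed border table the two coincide. -/
theorem wardTransversal_flipK_TbalOf_JsRecWAtOf_TW_su_exact₀ (hN : 2 ≤ N)
    (hLc : 1 ≤ Lc) {r : Fin (3 + 1) → ℕ} (hr : r ∈ box (3 + 1) Lc) (cΛ cB : ℝ) {cE₂ : ℝ}
    (hcE₂ : cE₂ = (Lc : ℝ) ^ (2 * (3 + 1)))
    {vh₂S : Fin (3 + 1) → (Fin (3 + 1) → ℤ) → Fin (3 + 1) → (Fin (3 + 1) → ℤ) → MKer (3 + 1) (Fib 3)}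
    (hB : ∃ C δ : ℝ, 0 < δ ∧ LocStencil₂ vh₂S C δ)
    (hBt : ∀ (κ : Fin (3 + 1)) (u : Fin (3 + 1) → ℤ) (κ' : Fin (3 + 1)) (u' t : Fin (3 + 1) → ℤ),
      vh₂S κ (u + (Lc : ℤ) • t) κ' (u' + (Lc : ℤ) • t) = shiftK (-((Lc : ℤ) • t)) (vh₂S κ u κ' u'))
    {mixFF : Fin (3 + 1) → (Fin (3 + 1) → ℤ) → Fin (3 + 1) → (Fin (3 + 1) → ℤ) → MKer (3 + 1) (Fib 3)}
    (hmix : ∃ C δ : ℝ, 0 < δ ∧ LocStencilFM Lc mixFF C δ)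
    (hmixt : ∀ (κ : Fin (3 + 1)) (u : Fin (3 + 1) → ℤ) (μ : Fin (3 + 1)) (w t : Fin (3 + 1) → ℤ),
      mixFF κ (u + (Lc : ℤ) • t) μ (w + t) = shiftK (-((Lc : ℤ) • t)) (mixFF κ u μ w))
    {RM₀ : (Fin (3 + 1) → ℤ) → Fin (3 + 1) → (Fin (3 + 1) → ℤ) → MKer (3 + 1) (Fib 3)}
    (hclsM₀ : ∃ C δ : ℝ, 0 < δ ∧ ∀ y, VertexFamily (RM₀ y) Lc C δ)
    (hRM₀p : ∀ y ρ' w, trK (RM₀ y ρ' w) = -sgnK (RM₀ y ρ' w))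
    (hBord0 : ∀ (Y : Fin (3 + 1) → ℤ) (κ' : Fin (3 + 1)) (u' : Fin (3 + 1) → ℤ),
      (stepScale 3 Lc 0 * (Lc : ℝ) ^ (3 + 1))⁻¹ • ∑ v ∈ box (3 + 1) Lc, divV (fun κ u => cB • vh₂S κ u κ' u') ((Lc : ℤ) • Y + toSite v) =
        comp ((-((Lc : ℝ) ^ (3 + 1) * (1 / 2) * (Lc : ℝ) ^ (3 + 1))) • vhSAt (toSite r) 3 Lc rfl κ' u') (diagK (((1 : ℝ) / 2) • ∑ v ∈ box (3 + 1) Lc, legInd (toSite r) ((Lc : ℤ) • Y + toSite v)))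
          - comp (diagK (((1 : ℝ) / 2) • ∑ v ∈ box (3 + 1) Lc, legInd (toSite r) ((Lc : ℤ) • Y + toSite v))) ((-((Lc : ℝ) ^ (3 + 1) * (1 / 2) * (Lc : ℝ) ^ (3 + 1))) • vhSAt (toSite r) 3 Lc rfl κ' u'))
    (hBord0'' : ∀ (Y : Fin (3 + 1) → ℤ) (κ : Fin (3 + 1)) (u : Fin (3 + 1) → ℤ),
      (stepScale 3 Lc 0 * (Lc : ℝ) ^ (3 + 1))⁻¹ • ∑ v ∈ box (3 + 1) Lc, divV (fun κ' u' => cB • vh₂S κ u κ' u') ((Lc : ℤ) • Y + toSite v) =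
        comp ((-((Lc : ℝ) ^ (3 + 1) * (1 / 2) * (Lc : ℝ) ^ (3 + 1))) • vhSAt (toSite r) 3 Lc rfl κ u) (diagK (((1 : ℝ) / 2) • ∑ v ∈ box (3 + 1) Lc, legInd (toSite r) ((Lc : ℤ) • Y + toSite v)))
          - comp (diagK (((1 : ℝ) / 2) • ∑ v ∈ box (3 + 1) Lc, legInd (toSite r) ((Lc : ℤ) • Y + toSite v))) ((-((Lc : ℝ) ^ (3 + 1) * (1 / 2) * (Lc : ℝ) ^ (3 + 1))) • vhSAt (toSite r) 3 Lc rfl κ u))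
    (hM₂0 : ∀ (y : Fin (3 + 1) → ℤ) (ρ' : Fin (3 + 1)) (w : Fin (3 + 1) → ℤ),
      (stepScale 3 Lc 0 * (Lc : ℝ) ^ (3 + 1))⁻¹ • ∑ v ∈ box (3 + 1) Lc, divV (fun κ u => M2Of 3 Lc mixFF 0 κ u ρ' w) ((Lc : ℤ) • y + toSite v) =
        comp (M1At 3 Lc (toSite r) cΛ 0 ρ' w) (diagK (((1 : ℝ) / 2) • ∑ v ∈ box (3 + 1) Lc, legInd (toSite r) ((Lc : ℤ) • y + toSite v)))
          - comp (diagK (((1 : ℝ) / 2) • ∑ v ∈ box (3 + 1) Lc, legInd (toSite r) ((Lc : ℤ) • y + toSite v))) (M1At 3 Lc (toSite r) cΛ 0 ρ' w)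
          + RM₀ y ρ' w) :
    ∀ j : ℕ, WardTransversal (flipK (TbalOf Lc
      (JsRecWAtOf (d := 3) hLc hr ((Lc : ℝ) ^ (3 + 1)) (-((Lc : ℝ) ^ (3 + 1) * (1 / 2) * (Lc : ℝ) ^ (3 + 1))) cΛ cE₂ cB
        ((8 * (N : ℝ) ^ 2)⁻¹ • wsym22 N) hB hmix) j)) := by
  refine wardTransversal_flipK_TbalOf_JsRecWAtOf_TW_su_exact hN hLc hr cΛ cB hcE₂ hB hBt hmix hmixt
    (RM := fun j y ρ' w => wM1 3 Lc j • RM₀ y ρ' w) (fun j => ?_) (fun j y ρ' w => parityOdd_smul (d := 3) (wM1 3 Lc j) (hRM₀p y ρ' w))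
    hBord0 hBord0'' (fun j Y κ' u' => ?_) (fun j Y κ u => ?_) (fun j y ρ' w => ?_)
  · -- one class per level, constant `|wM1 j| · C`
    obtain ⟨C, δ, hδ, hC⟩ := hclsM₀
    exact ⟨|wM1 3 Lc j| * C, δ, hδ, fun y => vertexFamily_smul (wM1 3 Lc j) (hC y)⟩
  · -- border, first slot, level j+1 from level 0
    refine exact_law_smul (w := wVH 3 Lc (j + 1)) ?_ ?_ (hBord0 Y κ' u')
    · rw [smul_sum_divV_smul, smul_sum_divV_smul, smul_smul, cH_mul_wB2 hLc cB (j + 1)]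
    · rw [← comm_smul, smul_smul, mul_comm (wVH 3 Lc (j + 1))]
  · -- border, second slot
    refine exact_law_smul (w := wVH 3 Lc (j + 1)) ?_ ?_ (hBord0'' Y κ u)
    · rw [smul_sum_divV_smul, smul_sum_divV_smul, smul_smul, cH_mul_wB2 hLc cB (j + 1)]
    · rw [← comm_smul, smul_smul, mul_comm (wVH 3 Lc (j + 1))]
  · -- mixed, level j from level 0, residual `wM1 j • RM₀`
    refine residual_law_smul (w := wM1 3 Lc j) ?_ ?_ (hM₂0 y ρ' w)
    · simp only [M2Of_apply]
      rw [smul_sum_divV_smul, smul_sum_divV_smul, smul_smul, cH_mul_wM2 hLc j]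
    · rw [← comm_smul, ← M1At_eq_smul_zero_level]

end Exact

end Summit.QuantumFields.BalabanUV.Beta.WardLocusParityLevels

end
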